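import Mathlib
import HarnessLib
import Summits.Ventures.LatticeQCDFlow.Scaling.AutoregressiveGaugeRedundancy

/-!
# LatticeQCDFlow / Scaling — corner moves: how blindness of an exact gauge-theory conditional
# propagates from link to link around a site

HONEST FRAMING: exact (Metropolis-corrected) sampling algorithms for lattice gauge theory;
figures of merit are autocorrelation/cost numbers at stated couplings and volumes; no
continuum-physics claim.

Venture `LatticeQCDFlow` (cell pub-lqcd), topic `Scaling`, FANOUT row 30 (lean-1, GEN-18) — OUR WORK,
bookkeeping for THEORY-2 §4 row C5 in the gauge case (sequel of `Scaling/AutoregressiveGaugeRedundancy`,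
used by `Scaling/AutoregressiveGaugeDominoReads*`).  Any dimension `d`, any `L`, any compact group `G`
with its Haar probability measure, any gauge-invariant weight `F`; `s` = integrated links,
`N = A_s F`, `M = A_{insert a s} F` (`Exactness.coordAvg`), `R = N/M` the exact autoregressive
conditional of the link `a`.  Say `R` is BLIND to a link `ℓ` if `R(U[ℓ ↦ v]) = R(U)` for all `U, v`.
At a site `y` whose links outside `s` are exactly two non-loop links `ℓ₁ ≠ ℓ₂`, the gauge rotation at
`y` moves only `U_{ℓ₁}, U_{ℓ₂}` among the retained links, and `N`, `M`, `R` are invariant under it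
(`coordAvg_eq_of_gaugeRelated_off`); consequently BLINDNESS PROPAGATES ACROSS THE CORNER:

* §1 the three corner moves for a marginal `A_s F`: `coordAvg_cornerOut` (both links leave `y`:
  `(gU_{ℓ₁}, gU_{ℓ₂})`), `coordAvg_cornerIn` (both arrive: `(U_{ℓ₁}g⁻¹, U_{ℓ₂}g⁻¹)`), and the tree's
  `coordAvg_pathHolonomy` (`ℓ₁` arrives, `ℓ₂` leaves: `(U_{ℓ₁}g⁻¹, gU_{ℓ₂})`); each also for
  `A_{insert a s} F` (`s ⊆ insert a s`).
* §2 **`arConditional_blind_iff_of_cornerThrough`**, **`…_of_cornerOut`**, **`…_of_cornerIn`** — under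
  the respective corner hypothesis, `R` is blind to `ℓ₁` IFF it is blind to `ℓ₂`.

READING (value-free): walking corner by corner along a retained path whose interior sites have all
their other links integrated, blindness of the exact conditional to one link of the path forces
blindness to every link of the path — so as soon as ONE of them is provably read, ALL are.  NOT CLAIMED:
anything quantitative.  Elementary over the parent; no `def`; nothing is cited as a fact; no `sorry`.
-/

noncomputable section

namespace Summit.Ventures.LatticeQCDFlow.Theory2.Autoregressive

open MeasureTheory Function
open Literature.MathematicalPhysics.QuantumFieldTheory
open Summit.Ventures.LatticeQCDFlow.Exactness

variable {d L : ℕ} {G : Type*} [Group G] [TopologicalSpace G] [IsTopologicalGroup G] [CompactSpace G]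
  [MeasurableSpace G] [BorelSpace G] [NeZero L]

/-! ## §1 Corner moves of a partial Haar marginal -/

/-- **Corner move, both links LEAVING `y`**: if the links at `y` outside `s` are exactly the two
non-loop links `ℓ₁ ≠ ℓ₂`, both starting at `y`, then `A_s F (U[ℓ₁ ↦ gU_{ℓ₁}][ℓ₂ ↦ gU_{ℓ₂}]) = A_s F (U)`
for gauge-invariant `F`. [ours] -/
theorem coordAvg_cornerOut {s : Finset (Edge d L)} {F : GaugeConfig d L G → ℝ} (hF : IsGaugeInvariant F)
    {y : Site d L} {ℓ₁ ℓ₂ : Edge d L} (hne : ℓ₁ ≠ ℓ₂)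
    (h₁ : ℓ₁.1 = y) (h₁' : ℓ₁.1.shift ℓ₁.2 ≠ y) (h₂ : ℓ₂.1 = y) (h₂' : ℓ₂.1.shift ℓ₂.2 ≠ y)
    (hstar : ∀ e : Edge d L, e.1 = y ∨ e.1.shift e.2 = y → e ≠ ℓ₁ → e ≠ ℓ₂ → e ∈ s)
    (U : GaugeConfig d L G) (g : G) :
    coordAvg (haarProbability G) s F (update (update U ℓ₁ (g * U ℓ₁)) ℓ₂ (g * U ℓ₂)) =
      coordAvg (haarProbability G) s F U := by
  refine coordAvg_eq_of_gaugeRelated_off s hF (Pi.mulSingle y g) fun e he => ?_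
  by_cases he₂ : e = ℓ₂
  · subst he₂
    rw [update_self, gaugeTransform_mulSingle_apply_of_fst_eq g U h₂ h₂']
  rw [update_of_ne he₂]
  by_cases he₁ : e = ℓ₁
  · subst he₁
    rw [update_self, gaugeTransform_mulSingle_apply_of_fst_eq g U h₁ h₁']
  rw [update_of_ne he₁]
  have hni : ¬ (e.1 = y ∨ e.1.shift e.2 = y) := fun hi => he (hstar e hi he₁ he₂)
  exact (gaugeTransform_mulSingle_apply_of_not_incident y g U (fun h1 => hni (Or.inl h1))
    (fun h2 => hni (Or.inr h2))).symm

/-- **Corner move, both links ARRIVING at `y`**: if the links at `y` outside `s` are exactly the two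
non-loop links `ℓ₁ ≠ ℓ₂`, both ending at `y`, then
`A_s F (U[ℓ₁ ↦ U_{ℓ₁}g⁻¹][ℓ₂ ↦ U_{ℓ₂}g⁻¹]) = A_s F (U)` for gauge-invariant `F`. [ours] -/
theorem coordAvg_cornerIn {s : Finset (Edge d L)} {F : GaugeConfig d L G → ℝ} (hF : IsGaugeInvariant F)
    {y : Site d L} {ℓ₁ ℓ₂ : Edge d L} (hne : ℓ₁ ≠ ℓ₂)
    (h₁ : ℓ₁.1.shift ℓ₁.2 = y) (h₁' : ℓ₁.1 ≠ y) (h₂ : ℓ₂.1.shift ℓ₂.2 = y) (h₂' : ℓ₂.1 ≠ y)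
    (hstar : ∀ e : Edge d L, e.1 = y ∨ e.1.shift e.2 = y → e ≠ ℓ₁ → e ≠ ℓ₂ → e ∈ s)
    (U : GaugeConfig d L G) (g : G) :
    coordAvg (haarProbability G) s F (update (update U ℓ₁ (U ℓ₁ * g⁻¹)) ℓ₂ (U ℓ₂ * g⁻¹)) =
      coordAvg (haarProbability G) s F U := by
  refine coordAvg_eq_of_gaugeRelated_off s hF (Pi.mulSingle y g) fun e he => ?_
  by_cases he₂ : e = ℓ₂
  · subst he₂
    rw [update_self, gaugeTransform_mulSingle_apply_of_shift_eq g U h₂' h₂]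
  rw [update_of_ne he₂]
  by_cases he₁ : e = ℓ₁
  · subst he₁
    rw [update_self, gaugeTransform_mulSingle_apply_of_shift_eq g U h₁' h₁]
  rw [update_of_ne he₁]
  have hni : ¬ (e.1 = y ∨ e.1.shift e.2 = y) := fun hi => he (hstar e hi he₁ he₂)
  exact (gaugeTransform_mulSingle_apply_of_not_incident y g U (fun h1 => hni (Or.inl h1))
    (fun h2 => hni (Or.inr h2))).symm

omit [Group G] [TopologicalSpace G] [IsTopologicalGroup G] [CompactSpace G] [MeasurableSpace G]
  [BorelSpace G] [NeZero L] in
/-- A corner hypothesis for `s` holds for `insert a s`. [ours] -/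
theorem cornerStar_insert {s : Finset (Edge d L)} {y : Site d L} {ℓ₁ ℓ₂ : Edge d L} (a : Edge d L)
    (hstar : ∀ e : Edge d L, e.1 = y ∨ e.1.shift e.2 = y → e ≠ ℓ₁ → e ≠ ℓ₂ → e ∈ s) :
    ∀ e : Edge d L, e.1 = y ∨ e.1.shift e.2 = y → e ≠ ℓ₁ → e ≠ ℓ₂ → e ∈ insert a s :=
  fun e he h1 h2 => Finset.mem_insert_of_mem (hstar e he h1 h2)

/-! ## §2 Blindness of the exact conditional propagates across a corner -/

/-- **THROUGH a corner** (`ℓ₁` arrives at `y`, `ℓ₂` leaves, all other links at `y` integrated): the exact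
conditional `R = A_s F / A_{insert a s} F` is blind to `ℓ₁` iff it is blind to `ℓ₂`. [ours] -/
theorem arConditional_blind_iff_of_cornerThrough {s : Finset (Edge d L)} {F : GaugeConfig d L G → ℝ}
    (hF : IsGaugeInvariant F) (a : Edge d L) {y : Site d L} {ℓ₁ ℓ₂ : Edge d L} (hne : ℓ₁ ≠ ℓ₂)
    (h₁ : ℓ₁.1.shift ℓ₁.2 = y) (h₁' : ℓ₁.1 ≠ y) (h₂ : ℓ₂.1 = y) (h₂' : ℓ₂.1.shift ℓ₂.2 ≠ y)
    (hstar : ∀ e : Edge d L, e.1 = y ∨ e.1.shift e.2 = y → e ≠ ℓ₁ → e ≠ ℓ₂ → e ∈ s) :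
    (∀ (U : GaugeConfig d L G) (v : G),
        coordAvg (haarProbability G) s F (update U ℓ₁ v) /
            coordAvg (haarProbability G) (insert a s) F (update U ℓ₁ v) =
          coordAvg (haarProbability G) s F U / coordAvg (haarProbability G) (insert a s) F U) ↔
      ∀ (U : GaugeConfig d L G) (v : G),
        coordAvg (haarProbability G) s F (update U ℓ₂ v) /
            coordAvg (haarProbability G) (insert a s) F (update U ℓ₂ v) =
          coordAvg (haarProbability G) s F U / coordAvg (haarProbability G) (insert a s) F U := by
  set N := coordAvg (haarProbability G) s F with hN
  set M := coordAvg (haarProbability G) (insert a s) F with hM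
  have hmove : ∀ (U : GaugeConfig d L G) (g : G),
      N (update (update U ℓ₁ (U ℓ₁ * g⁻¹)) ℓ₂ (g * U ℓ₂)) /
          M (update (update U ℓ₁ (U ℓ₁ * g⁻¹)) ℓ₂ (g * U ℓ₂)) = N U / M U := by
    intro U g
    rw [hN, hM, coordAvg_pathHolonomy hF hne h₁ h₁' h₂ h₂' hstar U g,
      coordAvg_pathHolonomy hF hne h₁ h₁' h₂ h₂' (cornerStar_insert a hstar) U g]
  constructor
  · intro hb U v
    -- `v = g * U ℓ₂` with `g = v * (U ℓ₂)⁻¹`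
    have h := hmove U (v * (U ℓ₂)⁻¹)
    rw [update_comm hne, hb, inv_mul_cancel_right] at h
    exact h
  · intro hb U v
    -- `v = U ℓ₁ * g⁻¹` with `g = v⁻¹ * U ℓ₁`
    have h := hmove U (v⁻¹ * U ℓ₁)
    rw [hb, mul_inv_rev, inv_inv, mul_inv_cancel_left] at h
    exact h

/-- **Both links LEAVING the corner** (all other links at `y` integrated): `R` is blind to `ℓ₁` iff
it is blind to `ℓ₂`. [ours] -/
theorem arConditional_blind_iff_of_cornerOut {s : Finset (Edge d L)} {F : GaugeConfig d L G → ℝ}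
    (hF : IsGaugeInvariant F) (a : Edge d L) {y : Site d L} {ℓ₁ ℓ₂ : Edge d L} (hne : ℓ₁ ≠ ℓ₂)
    (h₁ : ℓ₁.1 = y) (h₁' : ℓ₁.1.shift ℓ₁.2 ≠ y) (h₂ : ℓ₂.1 = y) (h₂' : ℓ₂.1.shift ℓ₂.2 ≠ y)
    (hstar : ∀ e : Edge d L, e.1 = y ∨ e.1.shift e.2 = y → e ≠ ℓ₁ → e ≠ ℓ₂ → e ∈ s) :
    (∀ (U : GaugeConfig d L G) (v : G),
        coordAvg (haarProbability G) s F (update U ℓ₁ v) /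
            coordAvg (haarProbability G) (insert a s) F (update U ℓ₁ v) =
          coordAvg (haarProbability G) s F U / coordAvg (haarProbability G) (insert a s) F U) ↔
      ∀ (U : GaugeConfig d L G) (v : G),
        coordAvg (haarProbability G) s F (update U ℓ₂ v) /
            coordAvg (haarProbability G) (insert a s) F (update U ℓ₂ v) =
          coordAvg (haarProbability G) s F U / coordAvg (haarProbability G) (insert a s) F U := by
  set N := coordAvg (haarProbability G) s F with hN
  set M := coordAvg (haarProbability G) (insert a s) F with hM
  have hmove : ∀ (U : GaugeConfig d L G) (g : G),
      N (update (update U ℓ₁ (g * U ℓ₁)) ℓ₂ (g * U ℓ₂)) /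
          M (update (update U ℓ₁ (g * U ℓ₁)) ℓ₂ (g * U ℓ₂)) = N U / M U := by
    intro U g
    rw [hN, hM, coordAvg_cornerOut hF hne h₁ h₁' h₂ h₂' hstar U g,
      coordAvg_cornerOut hF hne h₁ h₁' h₂ h₂' (cornerStar_insert a hstar) U g]
  constructor
  · intro hb U v
    have h := hmove U (v * (U ℓ₂)⁻¹)
    rw [update_comm hne, hb, inv_mul_cancel_right] at h
    exact h
  · intro hb U v
    have h := hmove U (v * (U ℓ₁)⁻¹)
    rw [hb, inv_mul_cancel_right] at h
    exact h

/-- **Both links ARRIVING at the corner** (all other links at `y` integrated): `R` is blind to `ℓ₁` iff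
it is blind to `ℓ₂`. [ours] -/
theorem arConditional_blind_iff_of_cornerIn {s : Finset (Edge d L)} {F : GaugeConfig d L G → ℝ}
    (hF : IsGaugeInvariant F) (a : Edge d L) {y : Site d L} {ℓ₁ ℓ₂ : Edge d L} (hne : ℓ₁ ≠ ℓ₂)
    (h₁ : ℓ₁.1.shift ℓ₁.2 = y) (h₁' : ℓ₁.1 ≠ y) (h₂ : ℓ₂.1.shift ℓ₂.2 = y) (h₂' : ℓ₂.1 ≠ y)
    (hstar : ∀ e : Edge d L, e.1 = y ∨ e.1.shift e.2 = y → e ≠ ℓ₁ → e ≠ ℓ₂ → e ∈ s) :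
    (∀ (U : GaugeConfig d L G) (v : G),
        coordAvg (haarProbability G) s F (update U ℓ₁ v) /
            coordAvg (haarProbability G) (insert a s) F (update U ℓ₁ v) =
          coordAvg (haarProbability G) s F U / coordAvg (haarProbability G) (insert a s) F U) ↔
      ∀ (U : GaugeConfig d L G) (v : G),
        coordAvg (haarProbability G) s F (update U ℓ₂ v) /
            coordAvg (haarProbability G) (insert a s) F (update U ℓ₂ v) =
          coordAvg (haarProbability G) s F U / coordAvg (haarProbability G) (insert a s) F U := by
  set N := coordAvg (haarProbability G) s F with hN
  set M := coordAvg (haarProbability G) (insert a s) F with hM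
  have hmove : ∀ (U : GaugeConfig d L G) (g : G),
      N (update (update U ℓ₁ (U ℓ₁ * g⁻¹)) ℓ₂ (U ℓ₂ * g⁻¹)) /
          M (update (update U ℓ₁ (U ℓ₁ * g⁻¹)) ℓ₂ (U ℓ₂ * g⁻¹)) = N U / M U := by
    intro U g
    rw [hN, hM, coordAvg_cornerIn hF hne h₁ h₁' h₂ h₂' hstar U g,
      coordAvg_cornerIn hF hne h₁ h₁' h₂ h₂' (cornerStar_insert a hstar) U g]
  constructor
  · intro hb U v
    have h := hmove U (v⁻¹ * U ℓ₂)
    rw [update_comm hne, hb, mul_inv_rev, inv_inv, mul_inv_cancel_left] at h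
    exact h
  · intro hb U v
    have h := hmove U (v⁻¹ * U ℓ₁)
    rw [hb, mul_inv_rev, inv_inv, mul_inv_cancel_left] at h
    exact h

end Summit.Ventures.LatticeQCDFlow.Theory2.Autoregressive

end
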